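import Summits.Langlands.Langlands.Theorems.IrreducibilityBySelfDualityPairLBoundaryJSWhittakerShiftTorusOff

/-!
# Crux `PairLBoundaryJS` (stmt-Langlands-13622), line `Sketch` — stub `stub_whittakerShiftTorus_off_integral` (L1'):
# the torus of Whittaker shifts OFF a finite set of places, with integrality off the different

Summit `Langlands`, sub-problem `Langlands`, helper file under `Theorems/` supporting the crux
`PairLBoundaryJS` (Arthur–Clozel (1989), Ch. 3, (2.2)), line `Sketch`, registered stub
`stub_whittakerShiftTorus_off_integral`.

This is `WhittakerShiftTorusOff.stub_whittakerShiftTorus_off` (the torus of Whittaker shifts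
`τ ∈ (𝔸_Kˣ)ⁿ` off a prescribed finite set `S₀`: `τ_i = (1, ∏_{w ∈ D} ι_w(ϖ_w⁻¹)^{e_w (n-1-i)})` with
`D = {v ∣ 𝔡_K} \ S₀`) re-run with TWO extra exported conjuncts: the finite set `S₁₀ := D` is disjoint
from `S₀`, and at every place `v ∉ S₁₀` the `v`-component of `diag τ` is INTEGRAL — it is the identity
there, since no factor of any `τ_{i,f}` lives at `v` (`Subgroup.one_mem (glInt n K_v)`). All other
conclusions and their proofs are verbatim those of the template: last entry `1`; trivial archimedean
part; trivial `v`-component at `v ∈ S₀`; at `v ∉ S₀` a diagonal `v`-component of constant ratio `a_v`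
with `ψ_{K,v}(a_v ·)` of conductor `𝒪_v` (the Whittaker shift at `v ∈ D` by
`AddChar.exists_shiftedConductor` and `whittakerShift_ratio`, the identity at `v ∉ D`, where `v ∤ 𝔡_K` and
`ψ_{K,v}` is unramified: `adicComponent_adeleAddChar_unramified`).

## References

* J. W. Cogdell, *Analytic theory of L-functions for GL_n*, in *An Introduction to the Langlands
  Program* (2004), §3.1 [CogdellAnalyticTheory2004].
* J. Tate, *Fourier analysis in number fields and Hecke's zeta-functions* (1950), §2.2, Lemma 2.2.2,
  in Cassels–Fröhlich, Ch. XV [CasselsFrohlichANT1967].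
-/

noncomputable section

-- `Summit.Langlands.Langlands.…` (summit = sub-problem name, D-0017 layout) trips `dupNamespace`
set_option linter.dupNamespace false

open scoped MatrixGroups Topology Pointwise ENNReal NNReal ComplexConjugate InnerProductSpace ContDiff
-- the place subtypes indexing `mixedSpace K` are `Fintype` classically (`NormedCommRing (mixedSpace K)`)
open scoped Classical Matrix.Norms.Operator
open NumberField IsDedekindDomain MeasureTheory Measure Matrix Set Filter WithZero
open NumberField.mixedEmbedding
open Literature.NumberTheory.Automorphic AdelicGroupData
open Literature.NumberTheory.GaloisRepresentations (ideleGroup HeckeCharacter)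
open ValuativeRel

namespace Summit.Langlands.Langlands.Theorems.WhittakerShiftTorusOffIntegral

/-- The `v`-component of the finite idele `ι_v(x)` is `x`. [folklore] -/
private theorem finiteAdeleEval_uniformizerIdele_self {K : Type} [Field K] [NumberField K]
    (v : HeightOneSpectrum (𝓞 K)) (x : (v.adicCompletion K)ˣ) :
    AdelicGroupData.finiteAdeleEval K v (uniformizerIdele K v x : FiniteAdeleRing (𝓞 K) K) = x := by
  rw [AdelicGroupData.finiteAdeleEval_apply, uniformizerIdele_apply_self]

/-- The `w`-component of the finite idele `ι_v(x)` is `1` for `w ≠ v`. [folklore] -/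
private theorem finiteAdeleEval_uniformizerIdele_of_ne {K : Type} [Field K] [NumberField K]
    {v w : HeightOneSpectrum (𝓞 K)} (h : w ≠ v) (x : (v.adicCompletion K)ˣ) :
    AdelicGroupData.finiteAdeleEval K w (uniformizerIdele K v x : FiniteAdeleRing (𝓞 K) K) = 1 := by
  rw [AdelicGroupData.finiteAdeleEval_apply, uniformizerIdele_apply_of_ne K v x h]

/-- A torus element all of whose entries are finite ideles `(1, x_f)` has trivial archimedean part:
`(diag τ)_∞ = 1`. [folklore] -/
private theorem toMixed_glDiagonal_unitsMap_inr {n : ℕ} {K : Type} [Field K] [NumberField K]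
    (τf : Fin n → (FiniteAdeleRing (𝓞 K) K)ˣ) :
    GLn.toMixed n K (glDiagonal n (AdeleRing (𝓞 K) K) fun i =>
        Units.map (MonoidHom.inr (InfiniteAdeleRing K) (FiniteAdeleRing (𝓞 K) K) :
          FiniteAdeleRing (𝓞 K) K →* AdeleRing (𝓞 K) K) (τf i)) = 1 := by
  have h1 : GLn.fstHom n K (glDiagonal n (AdeleRing (𝓞 K) K) fun i =>
      Units.map (MonoidHom.inr (InfiniteAdeleRing K) (FiniteAdeleRing (𝓞 K) K) :
        FiniteAdeleRing (𝓞 K) K →* AdeleRing (𝓞 K) K) (τf i)) = 1 := by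
    refine Matrix.GeneralLinearGroup.ext fun i j => ?_
    change ((glDiagonal n (AdeleRing (𝓞 K) K) _ : Matrix (Fin n) (Fin n) (AdeleRing (𝓞 K) K)) i j).1 = _
    rw [coe_glDiagonal, Matrix.diagonal_apply, Units.val_one, Matrix.one_apply]
    split_ifs <;> rfl
  rw [GLn.toMixed_apply, h1, map_one]

/-- **The torus of Whittaker shifts OFF a finite set `S₀`, with integrality off the different.**
`WhittakerShiftTorusOff.stub_whittakerShiftTorus_off` with one more conjunct: the `v`-component of `diag τ` is
INTEGRAL at every place outside the finite set `S₁₀ := {v ∣ 𝔡_K} \\ S₀` (it is `1` at `v ∈ S₀` and at `v ∤ 𝔡_K`), and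
`S₁₀` is disjoint from `S₀` (`Finset.disjoint_sdiff`). Same construction as the template
(`D := (finite_setOf_dvd_differentIdeal).toFinset \\ S₀`, `S₁₀ := D`, `τ_i = (1, ∏_{w ∈ D} ι_w(ϖ_w⁻¹)^{e_w (n-1-i)})`):
a torus element `τ ∈ (𝔸_Kˣ)ⁿ` with trivial archimedean part, last entry `1`, TRIVIAL `v`-component at every
`v ∉ D ⊇ S₀` (hence integral there), and at every `v ∉ S₀` a diagonal `v`-component of constant ratio `a_v` with
`ψ_{K,v}(a_v ·)` of conductor `𝒪_v` (the Whittaker shift at `v ∣ 𝔡_K`, the identity at `v ∤ 𝔡_K`: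
`adicComponent_adeleAddChar_unramified`).
[cite: CogdellAnalyticTheory2004, §3.1] [cite: CasselsFrohlichANT1967, Ch. XV (Tate), Lemma 2.2.2] -/
theorem stub_whittakerShiftTorus_off_integral :
    ∀ (n : ℕ) (K : Type) [Field K] [NumberField K] (S₀ : Finset (HeightOneSpectrum (𝓞 K))),
    ∃ (τ : Fin n → ideleGroup K) (S₁₀ : Finset (HeightOneSpectrum (𝓞 K))), Disjoint S₀ S₁₀ ∧
      (∀ v ∉ S₁₀, localComponent v (glDiagonal n (AdeleRing (𝓞 K) K) τ) ∈ glInt n (v.adicCompletion K)) ∧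
      lastEntry τ = 1 ∧ GLn.toMixed n K (glDiagonal n (AdeleRing (𝓞 K) K) τ) = 1 ∧
      (∀ v ∈ S₀, localComponent v (glDiagonal n (AdeleRing (𝓞 K) K) τ) = 1) ∧
      (∀ v ∉ S₀, ∃ (d : Fin n → (v.adicCompletion K)ˣ) (a : (v.adicCompletion K)ˣ),
        localComponent v (glDiagonal n (AdeleRing (𝓞 K) K) τ) = diagonalGL (Fin n) (v.adicCompletion K) d ∧
        (∀ i j : Fin n, (i : ℕ) + 1 = j → (d i : v.adicCompletion K) * ((d j)⁻¹ : (v.adicCompletion K)ˣ) = a) ∧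
        (∀ c ∈ 𝒪[v.adicCompletion K], (adeleAddChar K).adicComponent v (a * c) = 1) ∧
        ∀ ϖ : v.adicCompletion K, Valued.v ϖ = WithZero.exp (-1 : ℤ) →
          ∃ c ∈ 𝒪[v.adicCompletion K], (adeleAddChar K).adicComponent v (a * (ϖ⁻¹ * c)) ≠ 1) := by
  intro n K _ _ S₀
  -- a normalised uniformizer and the shifted conductor exponent of `ψ_{K,v}` at every finite place
  have hψ𝒪 : ∀ (v : HeightOneSpectrum (𝓞 K)), ∀ c ∈ 𝒪[v.adicCompletion K],
      (adeleAddChar K).adicComponent v c = 1 := fun v c hc =>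
    adeleAddCharAt_eq_one_of_mem K v
      ((HeightOneSpectrum.mem_adicCompletionIntegers _ _ _).2 ((mem_integer_adicCompletion_iff K v).1 hc))
  have hunif : ∀ v : HeightOneSpectrum (𝓞 K), ∃ ϖ : (v.adicCompletion K)ˣ,
      Valued.v (ϖ : v.adicCompletion K) = WithZero.exp (-1 : ℤ) := fun v => by
    obtain ⟨π, -, hπ⟩ := exists_coe_valued_eq_exp_neg_one v
    have hπ0 : (π : v.adicCompletion K) ≠ 0 := by
      intro h; rw [h, map_zero] at hπ; exact WithZero.exp_ne_zero hπ.symm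
    exact ⟨Units.mk0 _ hπ0, hπ⟩
  choose ϖ hϖ using hunif
  have hcond : ∀ v : HeightOneSpectrum (𝓞 K), ∃ e : ℕ,
      (∀ c ∈ 𝒪[v.adicCompletion K],
        (adeleAddChar K).adicComponent v (((ϖ v : v.adicCompletion K))⁻¹ ^ e * c) = 1) ∧
      ∃ c ∈ 𝒪[v.adicCompletion K],
        (adeleAddChar K).adicComponent v (((ϖ v : v.adicCompletion K))⁻¹ ^ e *
          (((ϖ v : v.adicCompletion K))⁻¹ * c)) ≠ 1 := fun v =>
    AddChar.exists_shiftedConductor (isUniformizingElement_of_valued_eq K v (hϖ v)) (hψ𝒪 v)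
      (adicComponent_adeleAddChar_ne_one v)
  choose e he he' using hcond
  -- the places above the different OFF `S₀`
  set D : Finset (HeightOneSpectrum (𝓞 K)) :=
    (finite_setOf_dvd_differentIdeal (K := K)).toFinset \ S₀ with hD
  -- the torus element
  set τf : Fin n → (FiniteAdeleRing (𝓞 K) K)ˣ := fun i =>
    ∏ w ∈ D, uniformizerIdele K w (ϖ w)⁻¹ ^ (e w * (n - 1 - (i : ℕ))) with hτf
  -- its local components (value level)
  have hval : ∀ (v : HeightOneSpectrum (𝓞 K)) (i : Fin n),
      AdelicGroupData.finiteAdeleEval K v (τf i : FiniteAdeleRing (𝓞 K) K) =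
        if v ∈ D then (((ϖ v : v.adicCompletion K))⁻¹) ^ (e v * (n - 1 - (i : ℕ))) else 1 := by
    intro v i
    simp only [hτf, Units.coe_prod, Units.val_pow_eq_pow_val, map_prod, map_pow]
    split_ifs with hv
    · rw [Finset.prod_eq_single v (fun w _ hw => by
          rw [finiteAdeleEval_uniformizerIdele_of_ne (Ne.symm hw), one_pow]) (fun h => (h hv).elim),
        finiteAdeleEval_uniformizerIdele_self, Units.val_inv_eq_inv_val]
    · exact Finset.prod_eq_one fun w hw => by
        rw [finiteAdeleEval_uniformizerIdele_of_ne (fun h => hv (by rw [h]; exact hw)), one_pow]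
  set τ : Fin n → ideleGroup K := fun i =>
    Units.map (MonoidHom.inr (InfiniteAdeleRing K) (FiniteAdeleRing (𝓞 K) K) :
      FiniteAdeleRing (𝓞 K) K →* AdeleRing (𝓞 K) K) (τf i) with hτ
  have hentry : ∀ (v : HeightOneSpectrum (𝓞 K)) (i : Fin n),
      AdelicGroupData.adeleEval K v (τ i : AdeleRing (𝓞 K) K) =
        if v ∈ D then (((ϖ v : v.adicCompletion K))⁻¹) ^ (e v * (n - 1 - (i : ℕ))) else 1 := fun v i => by
    rw [← hval v i]
    rfl
  -- the local component of `diag(τ)` is the diagonal matrix of the local components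
  have hcomp : ∀ (v : HeightOneSpectrum (𝓞 K)) (d : Fin n → (v.adicCompletion K)ˣ),
      (∀ i, (d i : v.adicCompletion K) =
        if v ∈ D then (((ϖ v : v.adicCompletion K))⁻¹) ^ (e v * (n - 1 - (i : ℕ))) else 1) →
      localComponent v (glDiagonal n (AdeleRing (𝓞 K) K) τ) = diagonalGL (Fin n) (v.adicCompletion K) d := by
    intro v d hd
    ext i j
    rw [localComponent, Matrix.GeneralLinearGroup.map_apply, coe_glDiagonal, coe_diagonalGL, Matrix.diagonal_apply,
      Matrix.diagonal_apply]
    split_ifs with hij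
    · subst hij
      rw [hentry, hd]
    · rw [map_zero]
  -- off `D` no factor of `τ_f` lives at `v`: the `v`-component is the identity
  have hone : ∀ v ∉ D, localComponent v (glDiagonal n (AdeleRing (𝓞 K) K) τ) = 1 := fun v hv => by
    rw [hcomp v 1 fun i => by rw [if_neg hv, Pi.one_apply, Units.val_one]]
    exact map_one _
  refine ⟨τ, D, ?_, fun v hvD => ?_, ?_, toMixed_glDiagonal_unitsMap_inr τf, fun v hvS => ?_, fun v hvS => ?_⟩
  · -- `S₀` and `S₁₀ = {v ∣ 𝔡_K} \ S₀` are disjoint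
    rw [hD]
    exact Finset.disjoint_sdiff
  · -- integrality off `S₁₀`: the `v`-component is the identity
    rw [hone v hvD]
    exact Subgroup.one_mem _
  · -- last entry
    unfold lastEntry
    split_ifs with h0
    · have : τf ⟨n - 1, Nat.sub_lt h0 one_pos⟩ = 1 := by
        simp only [hτf]
        exact Finset.prod_eq_one fun w _ => by
          rw [show n - 1 - (n - 1) = 0 from Nat.sub_self _, mul_zero, pow_zero]
      show Units.map _ (τf ⟨n - 1, Nat.sub_lt h0 one_pos⟩) = 1
      rw [this]
      exact map_one _
    · rfl
  · -- at `v ∈ S₀`: no factor of `τ_f` lives at `v`, the `v`-component is the identity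
    exact hone v fun h => (Finset.mem_sdiff.1 h).2 hvS
  · by_cases hv : v ∈ D
    · -- above the different, off `S₀`: the Whittaker shift
      refine ⟨fun i => (ϖ v)⁻¹ ^ (e v * (n - 1 - (i : ℕ))), (ϖ v)⁻¹ ^ e v, hcomp v _ fun i => ?_,
        fun i j hij => ?_, fun c hc => ?_, fun ϖ' hϖ' => ?_⟩
      · rw [if_pos hv, Units.val_pow_eq_pow_val, Units.val_inv_eq_inv_val]
      · have h := whittakerShift_ratio (n := n) (Units.ne_zero (ϖ v)) (e v) i j hij
        simp only [Units.mk0_val] at h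
        exact h
      · rw [Units.val_pow_eq_pow_val, Units.val_inv_eq_inv_val]
        exact he v c hc
      · obtain ⟨c, hc, hne⟩ := he' v
        have hϖ'0 : ϖ' ≠ 0 := by
          intro h; rw [h, map_zero] at hϖ'; exact WithZero.exp_ne_zero hϖ'.symm
        refine ⟨ϖ' * ((ϖ v : v.adicCompletion K))⁻¹ * c, ?_, ?_⟩
        · rw [mem_integer_adicCompletion_iff, map_mul, map_mul, map_inv₀, hϖ', hϖ v,
            mul_inv_cancel₀ WithZero.exp_ne_zero, one_mul]
          exact (mem_integer_adicCompletion_iff K v).1 hc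
        · rw [Units.val_pow_eq_pow_val, Units.val_inv_eq_inv_val, ← mul_assoc ϖ'⁻¹, ← mul_assoc ϖ'⁻¹,
            inv_mul_cancel₀ hϖ'0, one_mul]
          exact hne
    · -- off the different (as `v ∉ S₀` and `v ∉ D`): the identity, `ψ_{K,v}` has conductor `𝒪_v`
      have hvD : ¬ v.asIdeal ∣ differentIdeal ℤ (𝓞 K) := fun h =>
        hv (Finset.mem_sdiff.2 ⟨(finite_setOf_dvd_differentIdeal (K := K)).mem_toFinset.2 h, hvS⟩)
      obtain ⟨h1, h2⟩ := adicComponent_adeleAddChar_unramified (K := K) hvD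
      refine ⟨fun _ => 1, 1, hcomp v _ fun i => by rw [if_neg hv, Units.val_one],
        fun i j _ => by rw [inv_one, Units.val_one, mul_one], fun c hc => ?_, fun ϖ' hϖ' => ?_⟩
      · rw [Units.val_one, one_mul]; exact h1 c hc
      · obtain ⟨c, hc, hne⟩ := h2 ϖ' hϖ'
        exact ⟨c, hc, by rwa [Units.val_one, one_mul]⟩

end Summit.Langlands.Langlands.Theorems.WhittakerShiftTorusOffIntegral
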